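import Literature.Analysis.FluidPDE.SelfSimilarCollapseAnsatz
import Literature.Analysis.FluidPDE.VorticityCalculus
import Literature.Analysis.FluidPDE.NewtonKernel
import HarnessLib

/-!
# The residual of the exact collapse ansatz and its curl; the two-scale lemma

Cell `ns-blowup`, seat `ns-blowup-ecbridge-2` (g4; the E–C endpoint theory seat). LABEL: E–C typing
(KERNEL, FACT-FREE; one definition `profileInertia`). WHAT THIS IS NOT: not Navier–Stokes evidence —
exact calculus on a DESIGN (the self-similar collapse ansatz of the tree's `SelfSimilarCollapseAnsatz`);
nothing is constructed. Part 1 of 2; part 2 (`CollapseAnsatzVorticityObstruction.lean`) draws the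
consequence «the exact collapse ansatz is never an E–C design for `γ ≠ ½`, whatever the pressure».
Companion memos: `run/shared/lean/pub/ns-blowup/ecbridge2/ECBRIDGE-2-MEMO-2.md` §3, `…-MEMO-3.md`.

## Content

* `eq_zero_of_norm_rpow_smul_add_le`, `eq_zero_of_norm_rpow_smul_le`,
  `eq_zero_and_eq_zero_of_norm_rpow_smul_add_le` — TWO-SCALE LEMMA: if
  `‖(T−t)^α A + (T−t)^β B‖` stays bounded as `t ↑ T` with `α, β < 0`, `α ≠ β`, then `A = B = 0`;
* `profileInertia γ U := (1−γ)U + DU(γy) + (U·∇)U` and `residual_selfSimilarCollapse` — for ANY `C¹`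
  profile, `∂ₜu + (u·∇)u − νΔu = (T−t)^{γ−2}·N(y) − ν(T−t)^{−1−γ}·ΔU(y)` along
  `u = selfSimilarCollapse γ T U` (the tree's `timeDeriv/convect/laplacian_selfSimilarCollapse`, no
  profile equation assumed);
* `curl_residual_selfSimilarCollapse` — adding ANY `C²` pressure `q` and taking the curl:
  `curl(∂ₜu + (u·∇)u − νΔu + ∇q)(t, x) = (T−t)^{−2}·(curl N)(y) − ν(T−t)^{−1−2γ}·(curl ΔU)(y)`: the
  pressure is gone (`curl ∇q = 0`), and the two terms carry DIFFERENT powers of `T−t` iff `γ ≠ ½`.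

References: P. Constantin, M. Ignatova, V. Vicol, arXiv:2602.17570 (2026), §3.1 (3.2)–(3.3)
[cite: ConstantinIgnatovaVicol2026Putative, §3.1]; A. J. Majda, A. L. Bertozzi, *Vorticity and
Incompressible Flow* (CUP 2002), §1.1–§2.1 (curl of the equations, vector identities)
[cite: MajdaBertozziCUP2002, §2.1 eq. (2.5)].
-/

noncomputable section

namespace Summit.NavierStokesRegularity.FluidComputer.CollapseAnsatz

open Set Filter Topology Function InnerProductSpace MeasureTheory
open scoped Laplacian RealInnerProductSpace ENNReal
open Literature.Analysis.FluidPDE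

/-! ## §1 The two-scale lemma -/

section TwoScale

variable {F : Type*} [NormedAddCommGroup F] [NormedSpace ℝ F]

/-- **Two-scale lemma (dominant power).** If `‖(T−t)^α • A + (T−t)^β • B‖ ≤ M` for all
`t ∈ (t₁, T)` with `α < 0` and `α < β`, then `A = 0`: the more singular power must carry a zero
coefficient. [folklore] -/
theorem eq_zero_of_norm_rpow_smul_add_le {T t₁ α β M : ℝ} (ht₁ : t₁ < T) (hα : α < 0)
    (hαβ : α < β) {A B : F} (h : ∀ t ∈ Ioo t₁ T, ‖(T - t) ^ α • A + (T - t) ^ β • B‖ ≤ M) :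
    A = 0 := by
  by_contra hA
  have ha : 0 < ‖A‖ := norm_pos_iff.2 hA
  have hpos : 0 < β - α := sub_pos.2 hαβ
  -- `T - t → 0⁺` as `t ↑ T` (also in the tree as `SelfSimilarCensus.tendsto_sub_self_nhdsLT_nhdsGT`,
  -- whose module is not imported here)
  have h0 : Tendsto (fun t : ℝ => T - t) (𝓝[<] T) (𝓝[>] 0) := by
    refine tendsto_nhdsWithin_of_tendsto_nhds_of_eventually_within _ ?_ ?_
    · have : Tendsto (fun t : ℝ => T - t) (𝓝 T) (𝓝 (T - T)) :=
        (continuous_const.sub continuous_id).tendsto T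
      rw [sub_self] at this
      exact this.mono_left nhdsWithin_le_nhds
    · filter_upwards [self_mem_nhdsWithin] with t ht
      exact sub_pos.mpr (Set.mem_Iio.mp ht)
  -- `(T - t)^(β - α) ‖B‖ → 0`
  have h1 : Tendsto (fun t : ℝ => (T - t) ^ (β - α) * ‖B‖) (𝓝[<] T) (𝓝 0) := by
    have hc : Tendsto (fun s : ℝ => s ^ (β - α)) (𝓝[>] (0 : ℝ)) (𝓝 0) := by
      have := ((Real.continuous_rpow_const hpos.le).tendsto (0 : ℝ)).mono_left
        (nhdsWithin_le_nhds (s := Ioi (0 : ℝ)))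
      simpa [Real.zero_rpow hpos.ne'] using this
    simpa using (hc.comp h0).mul_const ‖B‖
  -- `(T - t)^α (‖A‖/2) → +∞`
  have h2 : Tendsto (fun t : ℝ => (T - t) ^ α * (‖A‖ / 2)) (𝓝[<] T) atTop :=
    ((tendsto_rpow_neg_nhdsGT_zero hα).comp h0).atTop_mul_const (half_pos ha)
  have hev1 := h1.eventually_lt_const (half_pos ha)
  have hev2 := h2.eventually_gt_atTop M
  obtain ⟨t, ⟨hlt1, hgt2⟩, htI⟩ := ((hev1.and hev2).and (Ioo_mem_nhdsLT ht₁)).exists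
  have hs : 0 < T - t := sub_pos.2 htI.2
  have hsα : 0 < (T - t) ^ α := Real.rpow_pos_of_pos hs α
  -- lower bound for the norm at this `t`
  have hsplit : (T - t) ^ β = (T - t) ^ α * (T - t) ^ (β - α) := by
    rw [← Real.rpow_add hs]; congr 1; ring
  have hnB : ‖(T - t) ^ β • B‖ ≤ (T - t) ^ α * (‖A‖ / 2) := by
    rw [norm_smul, Real.norm_of_nonneg (Real.rpow_nonneg hs.le β), hsplit, mul_assoc]
    exact mul_le_mul_of_nonneg_left hlt1.le hsα.le
  have hnA : ‖(T - t) ^ α • A‖ = (T - t) ^ α * ‖A‖ := by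
    rw [norm_smul, Real.norm_of_nonneg hsα.le]
  have hlow : (T - t) ^ α * ‖A‖ - (T - t) ^ α * (‖A‖ / 2) ≤
      ‖(T - t) ^ α • A + (T - t) ^ β • B‖ := by
    have htri := norm_sub_le ((T - t) ^ α • A + (T - t) ^ β • B) ((T - t) ^ β • B)
    rw [add_sub_cancel_right, hnA] at htri
    linarith
  have := h t htI
  have hhalf : (T - t) ^ α * ‖A‖ - (T - t) ^ α * (‖A‖ / 2) = (T - t) ^ α * (‖A‖ / 2) := by ring
  linarith

/-- **Two-scale lemma, one term.** If `‖(T−t)^α • A‖ ≤ M` on `(t₁, T)` with `α < 0` then `A = 0`.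
[folklore] -/
theorem eq_zero_of_norm_rpow_smul_le {T t₁ α M : ℝ} (ht₁ : t₁ < T) (hα : α < 0) {A : F}
    (h : ∀ t ∈ Ioo t₁ T, ‖(T - t) ^ α • A‖ ≤ M) : A = 0 :=
  eq_zero_of_norm_rpow_smul_add_le ht₁ hα (lt_add_one α) (B := (0 : F))
    (fun t ht => by simpa using h t ht)

/-- **Two-scale lemma, both coefficients.** If `‖(T−t)^α • A + (T−t)^β • B‖ ≤ M` on `(t₁, T)` with
`α, β < 0` and `α ≠ β`, then `A = 0` and `B = 0`. [folklore] -/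
theorem eq_zero_and_eq_zero_of_norm_rpow_smul_add_le {T t₁ α β M : ℝ} (ht₁ : t₁ < T) (hα : α < 0)
    (hβ : β < 0) (hne : α ≠ β) {A B : F}
    (h : ∀ t ∈ Ioo t₁ T, ‖(T - t) ^ α • A + (T - t) ^ β • B‖ ≤ M) : A = 0 ∧ B = 0 := by
  rcases lt_or_gt_of_ne hne with hlt | hgt
  · have hA := eq_zero_of_norm_rpow_smul_add_le ht₁ hα hlt h
    refine ⟨hA, eq_zero_of_norm_rpow_smul_le ht₁ hβ (M := M) fun t ht => ?_⟩
    simpa [hA] using h t ht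
  · have h' : ∀ t ∈ Ioo t₁ T, ‖(T - t) ^ β • B + (T - t) ^ α • A‖ ≤ M := fun t ht => by
      rw [add_comm]; exact h t ht
    have hB := eq_zero_of_norm_rpow_smul_add_le ht₁ hβ hgt h'
    refine ⟨eq_zero_of_norm_rpow_smul_le ht₁ hα (M := M) fun t ht => ?_, hB⟩
    simpa [hB] using h t ht

end TwoScale

/-! ## §2 The residual of the exact collapse ansatz and its curl -/

section Residual

variable {γ T t : ℝ}

/-- **The inertia of a collapse profile**: `N(y) = (1−γ) U(y) + DU(y)(γ y) + (U·∇)U(y)` — the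
bracket of `∂ₜu + (u·∇)u = (T−t)^{γ−2} N(y)` for `u = selfSimilarCollapse γ T U` (CIV (3.3) without
pressure and viscosity). [cite: ConstantinIgnatovaVicol2026Putative, §3.1 eq. (3.3)] -/
def profileInertia (γ : ℝ) (U : EuclideanSpace ℝ (Fin 3) → EuclideanSpace ℝ (Fin 3))
    (y : EuclideanSpace ℝ (Fin 3)) : EuclideanSpace ℝ (Fin 3) :=
  (1 - γ) • U y + fderiv ℝ U y (γ • y) + convect U U y

variable {U : EuclideanSpace ℝ (Fin 3) → EuclideanSpace ℝ (Fin 3)}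

/-- The inertia of a `C²` profile is `C¹`. [folklore] -/
theorem contDiff_profileInertia (hU : ContDiff ℝ 2 U) : ContDiff ℝ 1 (profileInertia γ U) := by
  have hU' : ContDiff ℝ 1 U := hU.of_le (by norm_cast)
  have hD : ContDiff ℝ 1 (fderiv ℝ U) := hU.fderiv_right (m := 1) (by norm_cast)
  have h1 : ContDiff ℝ 1 fun y => (1 - γ) • U y := hU'.const_smul (1 - γ)
  have h2 : ContDiff ℝ 1 fun y => fderiv ℝ U y (γ • y) := hD.clm_apply (contDiff_const_smul γ)
  have h3 : ContDiff ℝ 1 fun y => convect U U y := hD.clm_apply hU'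
  exact (h1.add h2).add h3

/-- **The pressure-free residual of the exact collapse ansatz** (any `C¹` profile, any `γ`, `ν`,
`t < T`, `y = (T−t)^{−γ} x`):
`∂ₜu + (u·∇)u − νΔu = (T−t)^{γ−2} • N(y) − (ν (T−t)^{−1−γ}) • ΔU(y)`.
[cite: ConstantinIgnatovaVicol2026Putative, §3.1 eq. (3.2)–(3.3)] -/
theorem residual_selfSimilarCollapse (ht : t < T) (hU : ContDiff ℝ 1 U) (ν : ℝ)
    (x : EuclideanSpace ℝ (Fin 3)) :
    timeDeriv (selfSimilarCollapse γ T U) t x +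
        convect (selfSimilarCollapse γ T U t) (selfSimilarCollapse γ T U t) x -
        ν • (Δ (selfSimilarCollapse γ T U t)) x =
      (T - t) ^ (γ - 2) • profileInertia γ U ((T - t) ^ (-γ) • x) -
        (ν * (T - t) ^ (-1 - γ)) • (Δ U) ((T - t) ^ (-γ) • x) := by
  rw [timeDeriv_selfSimilarCollapse ht hU, convect_selfSimilarCollapse ht,
    laplacian_selfSimilarCollapse ht, profileInertia]
  simp only [smul_add, smul_smul]

/-- **The curl of the residual with an ARBITRARY `C²` pressure**: for a `C³` profile,
`curl (∂ₜu + (u·∇)u − νΔu + ∇q)(t, x) = (T−t)^{−2} • (curl N)(y) − (ν (T−t)^{−1−2γ}) • (curl ΔU)(y)`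
— the pressure drops (`curl ∇q = 0`), the inertia carries `(T−t)^{−2}` and the viscous term
`(T−t)^{−1−2γ}`. [cite: MajdaBertozziCUP2002, §2.1 eq. (2.5)] -/
theorem curl_residual_selfSimilarCollapse (ht : t < T) (hU : ContDiff ℝ 3 U) (ν : ℝ)
    {q : EuclideanSpace ℝ (Fin 3) → ℝ} (hq : ContDiff ℝ 2 q) (x : EuclideanSpace ℝ (Fin 3)) :
    curl (fun z => timeDeriv (selfSimilarCollapse γ T U) t z +
        convect (selfSimilarCollapse γ T U t) (selfSimilarCollapse γ T U t) z -
        ν • (Δ (selfSimilarCollapse γ T U t)) z + gradient q z) x =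
      (T - t) ^ (-2 : ℝ) • curl (profileInertia γ U) ((T - t) ^ (-γ) • x) -
        (ν * (T - t) ^ (-1 - 2 * γ)) • curl (Δ U) ((T - t) ^ (-γ) • x) := by
  have hs : 0 < T - t := sub_pos.2 ht
  set c : ℝ := (T - t) ^ (-γ) with hc
  set A : EuclideanSpace ℝ (Fin 3) → EuclideanSpace ℝ (Fin 3) :=
    fun z => (T - t) ^ (γ - 2) • profileInertia γ U (c • z) with hA
  set B : EuclideanSpace ℝ (Fin 3) → EuclideanSpace ℝ (Fin 3) :=
    fun z => (ν * (T - t) ^ (-1 - γ)) • (Δ U) (c • z) with hB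
  set C : EuclideanSpace ℝ (Fin 3) → EuclideanSpace ℝ (Fin 3) := fun z => A z - B z with hC
  have hU1 : ContDiff ℝ 1 U := hU.of_le (by norm_cast)
  -- rewrite the field
  have hfun : (fun z => timeDeriv (selfSimilarCollapse γ T U) t z +
        convect (selfSimilarCollapse γ T U t) (selfSimilarCollapse γ T U t) z -
        ν • (Δ (selfSimilarCollapse γ T U t)) z + gradient q z) =
      fun z => C z + gradient q z := by
    funext z
    rw [residual_selfSimilarCollapse ht hU1 ν z]
  -- differentiability of the pieces
  have hN1 : ContDiff ℝ 1 (profileInertia γ U) := contDiff_profileInertia (hU.of_le (by norm_cast))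
  have hΔ1 : ContDiff ℝ 1 (Δ U) := contDiff_laplacian (n := 1) (by exact_mod_cast hU)
  have hlin : ContDiff ℝ 1 fun z : EuclideanSpace ℝ (Fin 3) => c • z := contDiff_const_smul c
  have hAd : DifferentiableAt ℝ A x :=
    (((hN1.comp hlin).const_smul ((T - t) ^ (γ - 2))).differentiable one_ne_zero) x
  have hBd : DifferentiableAt ℝ B x :=
    (((hΔ1.comp hlin).const_smul (ν * (T - t) ^ (-1 - γ))).differentiable one_ne_zero) x
  have hG1 : ContDiff ℝ 1 fun z => gradient q z :=
    (InnerProductSpace.toDual ℝ (EuclideanSpace ℝ (Fin 3))).symm.contDiff.comp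
      (hq.fderiv_right (m := 1) (by norm_cast))
  have hGd : DifferentiableAt ℝ (gradient q) x := (hG1.differentiable one_ne_zero) x
  have hCd : DifferentiableAt ℝ C x := hAd.sub hBd
  have e1 : γ - 2 + -γ = (-2 : ℝ) := by ring
  have e2 : -1 - γ + -γ = -1 - 2 * γ := by ring
  rw [hfun, curl_add hCd hGd, hC, curl_sub hAd hBd, curl_gradient_eq_zero_holds q hq x,
    add_zero, hA, hB, curl_smul_comp_smul, curl_smul_comp_smul, hc, mul_assoc,
    ← Real.rpow_add hs, ← Real.rpow_add hs, e1, e2]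

end Residual

end Summit.NavierStokesRegularity.FluidComputer.CollapseAnsatz

end
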